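import Mathlib

/-!
# Parabola-free sets of `ℤ_p²`: a kernel-verified branch and bound
(stub `stub_tangencySets` of the crux `LevelOneGL2Designs`, stmt-MatrixMultiplication-14080;
wall-breaker axis 5/12, *parabola lifts over finite fields*, family P2-mod)

`T ⊆ ℤ_p × ℤ_p` is parabola-free when no two points differ by `(r, ±r²)`, `r ≠ 0` — the index sets
of parabola lifts with wrap-around.  Writing `T = ⋃ₓ {x} × C_x` by columns, the condition says:
for columns `x ≠ y`, `C_y` avoids `C_x ± (y − x)²`.  This file is the COMPUTATIONAL half of the
exact determination of `α₇ = 10` and `α₁₁ = 23` (planner sub-stubs `stub_parabolaFreeAt_7_not_11`,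
`stub_parabolaFreeAt_11_not_24`): a branch and bound over columns on bit masks, written so that the
Lean kernel can run it (`decide +kernel`, no `native_decide`), together with the semantics of its bit-level
primitives; the soundness theorems (`search_false`, `topA_false`) are in
`…ParabolaFreeSearchSound.lean`, the reduction from finite sets of `ZMod p × ZMod p` (translation to
a maximal column through the origin, dilation to a canonical column-0 set) and the instances in the
companion files `…ParabolaFreeExact*.lean`.

Data layout: a column set is a `p`-bit mask; the vector of still-available sets of all columns is
packed into one natural number, column `y` occupying bits `[16y, 16y + p)` (so `p ≤ 16`); the
closed neighbourhood of a vertex `(x, c)` in this packing is tabulated once (`NBT`).  The search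
(`search`) repeatedly takes a most-constrained remaining column, enumerates its admissible subsets
(`choose`, at most `cap` = size of the maximal column 0) and prunes with the bound
`Σ_y min(cap, |avail_y|)`.  Nothing in the search depends on the parabola: the graph enters only
through the table `nbT`.  Kernel cost (farm, 2026-08-16): `p = 7` complete in 3 s; `p = 11` about
2.5 ms per search node, 1.45·10⁵ nodes over the 109 canonical column-0 sets.
-/

set_option linter.dupNamespace false -- `MatrixMultiplication.MatrixMultiplication` (summit = problem, D-0017)

namespace Summit.MatrixMultiplication.MatrixMultiplication.Theorems.LevelOneGL2Designs.PFS

/-! ## The program -/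

/-- all-ones mask of width `p` -/
def full (p : ℕ) : ℕ := 2 ^ p - 1

/-- reference popcount of the low `q` bits -/
def pcSlow : ℕ → ℕ → ℕ
  | 0, _ => 0
  | q + 1, m => (m &&& 1) + pcSlow q (m >>> 1)

/-- popcount table under construction: entry `k < 2^p` at bits `[4k, 4k+4)` -/
def mkPT (p : ℕ) : ℕ → ℕ → ℕ
  | 0, acc => acc
  | k + 1, acc => mkPT p k (acc ||| (pcSlow p k <<< (4 * k)))

/-- the popcount table for width `p` -/
def PT (p : ℕ) : ℕ := mkPT p (2 ^ p) 0

/-- table popcount (meant for `m < 2^p`, `p ≤ 15`; its correctness is an explicit hypothesis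
`∀ m < 2^p, pc p m = (bitsOf p m).length` of the soundness theorems, decided per `p`) -/
def pc (p m : ℕ) : ℕ := (PT p >>> (4 * m)) &&& 15

/-- lane `y` (16 bits apart, `p` bits wide) of a packed vector of column masks -/
def lane (p AV y : ℕ) : ℕ := (AV >>> (16 * y)) &&& full p

/-- the shift `(y - x)² mod p` between columns `x` and `y` -/
def sOf (p x y : ℕ) : ℕ := ((y + p - x) % p) ^ 2 % p

/-- packed neighbourhood of the vertex `(x, c)` restricted to columns `< Y`: in lane `y ≠ x` the
two residues `c ± (y - x)²` -/
def nbGo (p x c : ℕ) : ℕ → ℕ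
  | 0 => 0
  | y + 1 =>
    nbGo p x c y |||
      (if y = x then 0 else
        (2 ^ ((c + sOf p x y) % p) ||| 2 ^ ((c + p - sOf p x y) % p)) <<< (16 * y))

/-- packed neighbourhood of the vertex `(x, c)` -/
def nb (p x c : ℕ) : ℕ := nbGo p x c p

/-- neighbourhood table under construction: entry `v = x p + c` at bit offset `16 p v` -/
def mkNBT (p : ℕ) : ℕ → ℕ → ℕ
  | 0, acc => acc
  | v + 1, acc => mkNBT p v (acc ||| (nb p (v / p) (v % p) <<< (16 * p * v)))

/-- the neighbourhood table -/
def NBT (p : ℕ) : ℕ := mkNBT p (p * p) 0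

/-- table lookup of the neighbourhood of `(x, c)` (correctness `nbT = nb` on `[0,p)²` is an
explicit hypothesis of the final theorems, decided per `p`) -/
def nbT (p x c : ℕ) : ℕ := (NBT p >>> (16 * p * (x * p + c))) &&& (2 ^ (16 * p) - 1)

/-- one pass over the remaining columns: the bound `Σ min cap |avail_y|` and a most-constrained
column together with its count (`none` for no columns) -/
def scan (p cap AV : ℕ) : List ℕ → ℕ × Option (ℕ × ℕ)
  | [] => (0, none)
  | y :: ys =>
    match scan p cap AV ys with
    | (b, none) => (min cap (pc p (lane p AV y)) + b, some (y, pc p (lane p AV y)))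
    | (b, some (y', a')) =>
      (min cap (pc p (lane p AV y)) + b,
        if pc p (lane p AV y) ≤ a' then some (y, pc p (lane p AV y)) else some (y', a'))

/-- the set bit positions `< p` of `a`, increasing -/
def bitsOf (p a : ℕ) : List ℕ := (List.range p).filter fun i => a.testBit i

/-- enumerate the subsets `C` of the listed bits of column `x` with `lo ≤ cnt + |C|`,
`cnt + |C| ≤ cap`, accumulating the killed set `kacc`; `k kacc' cnt'` is called at every admissible
subset and the result is `true` iff some call is (`len` ≥ number of listed bits, for pruning) -/
def choose (p cap lo x : ℕ) (k : ℕ → ℕ → Bool) : List ℕ → ℕ → ℕ → ℕ → Bool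
  | [], _, kacc, cnt => if lo ≤ cnt then k kacc cnt else false
  | i :: is, len, kacc, cnt =>
    if cnt + len < lo then false else
      (cnt < cap && choose p cap lo x k is (len - 1) (kacc ||| nbT p x i) (cnt + 1)) ||
        choose p cap lo x k is (len - 1) kacc cnt

/-- the search; `false` means: no admissible choice of sets for the remaining columns `cols`
(available bits packed in `AV`, at most `cap` bits per column, pairwise non-adjacent) brings
`total` up to `need` -/
def search (p : ℕ) : ℕ → List ℕ → ℕ → ℕ → ℕ → ℕ → Bool
  | 0, _, _, _, _, _ => true
  | fuel + 1, cols, AV, total, cap, need =>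
    if need ≤ total then true else
    match scan p cap AV cols with
    | (_, none) => false
    | (b, some (x, a)) =>
      if total + b < need then false else
        choose p cap (need - (total + (b - min cap a))) x
          (fun kacc cnt => search p fuel (cols.erase x) ((AV ||| kacc) ^^^ kacc) (total + cnt) cap need)
          (bitsOf p (lane p AV x)) (bitsOf p (lane p AV x)).length 0 0

/-- lanes `1 … Y-1` full -/
def fullAV (p : ℕ) : ℕ → ℕ
  | 0 => 0
  | y + 1 => fullAV p y ||| (if y = 0 then 0 else full p <<< (16 * y))

/-- the packed set killed by the column-0 set with the listed elements -/
def killA (p : ℕ) : List ℕ → ℕ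
  | [] => 0
  | i :: is => nbT p 0 i ||| killA p is

/-- the columns `1, …, p - 1` -/
def cols₀ (p : ℕ) : List ℕ := (List.range (p - 1)).map (· + 1)

/-- top level for one column-0 set `A` (a `p`-bit mask) and cap `m`: `false` certifies that no
admissible family of sets for the columns `1 … p-1`, each of size `≤ m` and compatible with `A` in
column `0`, has `m + Σ |C_y| ≥ K` -/
def topA (p K m A : ℕ) : Bool :=
  search p p (cols₀ p) ((fullAV p p ||| killA p (bitsOf p A)) ^^^ killA p (bitsOf p A)) m m K

/-- dilation of a `p`-bit mask restricted to bits `< I`: bit `i` ↦ bit `η i % p` -/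
def dilGo (p η A : ℕ) : ℕ → ℕ
  | 0 => 0
  | i + 1 => dilGo p η A i ||| (if A.testBit i then 2 ^ (η * i % p) else 0)

/-- dilation of a `p`-bit mask by the multiplier `η` -/
def dil (p η A : ℕ) : ℕ := dilGo p η A p

/-- canonical: numerically minimal in its orbit under the dilations `η ∈ [1, p)` -/
def isCanon (p A : ℕ) : Bool := (List.range (p - 1)).all fun i => decide (A ≤ dil p (i + 1) A)

/-- all odd masks `A < 2^p` (i.e. `0 ∈ A`) of popcount `m` that are canonical -/
def canonA (p m : ℕ) : List ℕ :=
  ((List.range (2 ^ (p - 1))).filter fun t => pc p (2 * t + 1) == m && isCanon p (2 * t + 1)).map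
    fun t => 2 * t + 1

/-- every canonical column-0 set of size `m` fails to reach `K` -/
def refuteM (p K m : ℕ) : Bool := (canonA p m).all fun A => !topA p K m A

/-! ## Semantics of the bit-level operations -/

/-- bits of the all-ones mask -/
theorem testBit_full (p i : ℕ) : (full p).testBit i = decide (i < p) :=
  Nat.testBit_two_pow_sub_one p i

/-- bits of a lane of the packing -/
theorem testBit_lane (p AV y j : ℕ) :
    (lane p AV y).testBit j = (AV.testBit (16 * y + j) && decide (j < p)) := by
  simp [lane, testBit_full]

/-- a lane is a `p`-bit mask -/
theorem lane_lt (p AV y : ℕ) : lane p AV y < 2 ^ p :=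
  Nat.lt_pow_two_of_testBit _ fun i hi => by simp [testBit_lane, Nat.not_lt.2 hi]

/-- membership in the list of set bits -/
theorem mem_bitsOf {p a i : ℕ} : i ∈ bitsOf p a ↔ i < p ∧ a.testBit i = true := by
  simp [bitsOf, List.mem_filter]

/-- the list of set bits has no duplicates -/
theorem bitsOf_nodup (p a : ℕ) : (bitsOf p a).Nodup := (List.nodup_range).filter _

/-- if the bits of `a` are among those of `b` then `bitsOf p a` is the sub-list of `bitsOf p b`
cut out by `a` -/
theorem bitsOf_eq_filter {p a b : ℕ} (h : ∀ i, a.testBit i = true → b.testBit i = true) :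
    bitsOf p a = (bitsOf p b).filter fun i => a.testBit i := by
  rw [bitsOf, bitsOf, List.filter_filter]
  refine List.filter_congr fun i _ => ?_
  cases ha : a.testBit i
  · simp
  · simp [h i ha]

/-- bit inclusion gives a sub-list of set bits -/
theorem bitsOf_sublist {p a b : ℕ} (h : ∀ i, a.testBit i = true → b.testBit i = true) :
    (bitsOf p a).Sublist (bitsOf p b) := by
  rw [bitsOf_eq_filter h]; exact List.filter_sublist

/-- bit inclusion is monotone on the number of set bits -/
theorem length_bitsOf_le {p a b : ℕ} (h : ∀ i, a.testBit i = true → b.testBit i = true) :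
    (bitsOf p a).length ≤ (bitsOf p b).length :=
  (bitsOf_sublist h).length_le

/-- `(A ||| K) ^^^ K` is `A` with the bits of `K` cleared -/
theorem testBit_andNot (A K n : ℕ) :
    ((A ||| K) ^^^ K).testBit n = (A.testBit n && !K.testBit n) := by
  rw [Nat.testBit_xor, Nat.testBit_or]
  cases A.testBit n <;> cases K.testBit n <;> rfl

/-- bits of an accumulated union -/
theorem testBit_foldl_or (f : ℕ → ℕ) (S : List ℕ) (k0 n : ℕ) :
    (S.foldl (fun acc i => acc ||| f i) k0).testBit n = true ↔
      k0.testBit n = true ∨ ∃ i ∈ S, (f i).testBit n = true := by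
  induction S generalizing k0 with
  | nil => simp
  | cons i S ih =>
    rw [List.foldl_cons, ih]
    simp only [Nat.testBit_or, Bool.or_eq_true, List.mem_cons, exists_eq_or_imp]
    tauto

/-- bits killed by the column-0 set: the union of the tabulated neighbourhoods -/
theorem testBit_killA (p : ℕ) (L : List ℕ) (n : ℕ) :
    (killA p L).testBit n = true ↔ ∃ i ∈ L, (nbT p 0 i).testBit n = true := by
  induction L with
  | nil => simp [killA]
  | cons i L ih => simp [killA, Nat.testBit_or, ih]

/-- the shift between two columns is a residue -/
theorem sOf_lt {p : ℕ} (hp : 0 < p) (x y : ℕ) : sOf p x y < p := Nat.mod_lt _ hp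

/-- bits of the packed neighbourhood -/
theorem testBit_nbGo {p : ℕ} (hp : 0 < p) (hp16 : p ≤ 16) (x c : ℕ) {j : ℕ} (hj : j < 16) :
    ∀ Y y : ℕ, (nbGo p x c Y).testBit (16 * y + j) = true ↔
      y < Y ∧ y ≠ x ∧ (j = (c + sOf p x y) % p ∨ j = (c + p - sOf p x y) % p) := by
  intro Y
  induction Y with
  | zero => simp [nbGo]
  | succ Y ih =>
    intro y
    rw [nbGo, Nat.testBit_or, Bool.or_eq_true, ih y]
    by_cases hYx : Y = x
    · simp only [hYx, if_true, Nat.zero_testBit]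
      constructor
      · rintro (⟨h1, h2, h3⟩ | h)
        · exact ⟨by omega, h2, h3⟩
        · exact absurd h Bool.false_ne_true
      · rintro ⟨h1, h2, h3⟩
        exact Or.inl ⟨by omega, h2, h3⟩
    · simp only [hYx, if_false, Nat.testBit_shiftLeft, Nat.testBit_or, Nat.testBit_two_pow,
        Bool.and_eq_true, decide_eq_true_eq, Bool.or_eq_true]
      have h1 : (c + sOf p x Y) % p < 16 := (Nat.mod_lt _ hp).trans_le hp16
      have h2 : (c + p - sOf p x Y) % p < 16 := (Nat.mod_lt _ hp).trans_le hp16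
      constructor
      · rintro (⟨h3, h4, h5⟩ | ⟨h3, h4⟩)
        · exact ⟨by omega, h4, h5⟩
        · have hy : y = Y := by
            rcases h4 with h4 | h4 <;> omega
          subst hy
          refine ⟨by omega, hYx, ?_⟩
          rcases h4 with h4 | h4
          · left; omega
          · right; omega
      · rintro ⟨h3, h4, h5⟩
        rcases Nat.lt_succ_iff_lt_or_eq.1 h3 with h3 | rfl
        · exact Or.inl ⟨h3, h4, h5⟩
        · right
          refine ⟨by omega, ?_⟩
          rcases h5 with h5 | h5
          · left; omega
          · right; omega

/-- bits of the packed neighbourhood of a vertex: in lane `y ≠ x`, exactly the two residues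
`c ± (y-x)²` -/
theorem testBit_nb {p : ℕ} (hp : 0 < p) (hp16 : p ≤ 16) (x c : ℕ) {y j : ℕ} (hy : y < p)
    (hj : j < 16) :
    (nb p x c).testBit (16 * y + j) = true ↔
      y ≠ x ∧ (j = (c + sOf p x y) % p ∨ j = (c + p - sOf p x y) % p) := by
  rw [nb, testBit_nbGo hp hp16 x c hj]
  exact ⟨fun h => h.2, fun h => ⟨hy, h⟩⟩

/-- bits of the initial packing -/
theorem testBit_fullAV {p : ℕ} (hp16 : p ≤ 16) {j : ℕ} (hj : j < 16) :
    ∀ Y y : ℕ, (fullAV p Y).testBit (16 * y + j) = true ↔ y < Y ∧ y ≠ 0 ∧ j < p := by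
  intro Y
  induction Y with
  | zero => simp [fullAV]
  | succ Y ih =>
    intro y
    rw [fullAV, Nat.testBit_or, Bool.or_eq_true, ih y]
    by_cases hY0 : Y = 0
    · simp only [hY0, if_true, Nat.zero_testBit]
      constructor
      · rintro (⟨h1, h2, h3⟩ | h)
        · exact ⟨by omega, h2, h3⟩
        · exact absurd h Bool.false_ne_true
      · rintro ⟨h1, h2, h3⟩
        omega
    · simp only [hY0, if_false, Nat.testBit_shiftLeft, testBit_full, Bool.and_eq_true,
        decide_eq_true_eq]
      constructor
      · rintro (⟨h3, h4, h5⟩ | ⟨h3, h4⟩)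
        · exact ⟨by omega, h4, h5⟩
        · exact ⟨by omega, by omega, by omega⟩
      · rintro ⟨h3, h4, h5⟩
        rcases Nat.lt_succ_iff_lt_or_eq.1 h3 with h3 | rfl
        · exact Or.inl ⟨h3, h4, h5⟩
        · exact Or.inr ⟨by omega, by omega⟩

end Summit.MatrixMultiplication.MatrixMultiplication.Theorems.LevelOneGL2Designs.PFS
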